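import Summits.CriticalPhenomena.Ising3DConformalLimit.Theorems.LeeYangGapMoebiusLimitExistsLatticeWardDoor
import Summits.CriticalPhenomena.Ising3DConformalLimit.Theorems.PlantedPinningMoebiusLimitExistsWardDoor
import HarnessLib

/-!
# The lattice form of the single-generator residual 7⁗ of line `Sketch` v11 (crux `MoebiusLimitExists`, stmt-CriticalPhenomena-1344)
(lead prover-line-stmt-CriticalPhenomena-1344-c17-0, instance route LeeYangGap; THEOREM-ONLY, `--supports stmt-CriticalPhenomena-1344`)

Skeleton v11 (lead c17) registers the residual 7⁗ `stub_interiorWardK1EvenGeFour`: the weak special-conformal Ward identity for the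
SINGLE generator `K_{e₀}` (`e₀ = EuclideanSpace.single 0 1`) at the EVEN levels `n ≥ 4` of an interacting open-window Ising₃ limit,
spelled with the coefficient `2Δ − 6` inlined.  The lattice Ward door (`LeeYangGapMoebiusLimitExistsLatticeWardDoor`,
`integral_mul_sctTestOp_eq_zero_iff_tendsto`) converts each such identity, test pair by test pair, into the statement that the LATTICE
Ward functional of the rescaled critical correlators tends to zero.  This file records the conversion in 7⁗'s verbatim spelling:

* `sctTestOp_three` — `sctTestOp Δ n b φ x` on `ℝ³` with the coefficient `2Δ − 6`;
* `integral_ward_eq_zero_iff_tendsto_lattice` — for ONE level `n`, ONE generator `b` and ONE test function `φ`: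
  `∫ S n · 𝒦ᵀ_bφ = 0 ⟺ ∫ ρ(δ)ⁿ ⟨σ_[x₁/δ] ⋯ σ_[xₙ/δ]⟩⁺_{β_c} 𝒦ᵀ_bφ(x) dx → 0 (δ → 0⁺)` (inlined coefficient);
* `k1Ward_iff_latticeK1Ward` (registered anchor) — **7⁗ ⟺ 7⁗_lat hypothesis-wise**: for every pointwise limit `S` of `criticalCorr 3`
  under `ρ` and every `Δ`, the single-generator even-level (`n ≥ 4`) weak Ward identities of `S` hold iff the rescaled LATTICE correlators
  satisfy them asymptotically — the sharpest residual of crux 1344 on record, stated on the genuine critical correlators of `ℤ³` with no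
  limit object in the conclusion: the exact target of a discrete `K₁` Ward identity.

References: Di Francesco–Mathieu–Sénéchal 1997 §4.1 (4.18), §4.3.1 (4.51)–(4.54) [FrancescoMathieuSenechal1997].  No definitions, no `sorry`.
-/

noncomputable section

namespace Summit.CriticalPhenomena.Ising3DConformalLimit.MoebiusLimitExistsLatticeWard

open Filter Topology MeasureTheory Set
open Literature.Probability.LatticeModels
open Summit.CriticalPhenomena.Ising3DConformalLimit.MoebiusLimitExistsWardDoor (continuousOn_of_limit coeff_three)

/-- `𝒦ᵀ_b` on `ℝ³` with the numerical coefficient `2Δ − 6`. [cite: FrancescoMathieuSenechal1997, §4.1 (4.18)] -/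
theorem sctTestOp_three (Δ : ℝ) (n : ℕ) (b : EuclideanSpace ℝ (Fin 3)) (φ : (Fin n → EuclideanSpace ℝ (Fin 3)) → ℝ)
    (x : Fin n → EuclideanSpace ℝ (Fin 3)) :
    sctTestOp Δ n b φ x = (2 * Δ - 6) * (∑ i, inner ℝ b (x i)) * φ x +
      fderiv ℝ φ x (fun i => ‖x i‖ ^ 2 • b - (2 * inner ℝ b (x i)) • x i) := by
  unfold sctTestOp
  rw [coeff_three]

/-- **One level, one generator, one test function**: for a pointwise limit `S` of the critical `ℤ³` correlators, the weak Ward identity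
`∫ S n · 𝒦ᵀ_bφ = 0` holds iff the lattice Ward functional `δ ↦ ∫ ρ(δ)ⁿ ⟨σ_[x₁/δ] ⋯ σ_[xₙ/δ]⟩⁺_{β_c} 𝒦ᵀ_bφ(x) dx` tends to `0` as `δ → 0⁺`
(coefficient `2Δ − 6` inlined, as in the skeleton). [cite: FrancescoMathieuSenechal1997, §4.3.1 (4.51)–(4.54)] -/
theorem integral_ward_eq_zero_iff_tendsto_lattice {ρ : ℝ → ℝ} {S : CorrFamily 3}
    (hlim : HasPointwiseScalingLimit (criticalCorr 3) ρ S) (Δ : ℝ) {n : ℕ} (b : EuclideanSpace ℝ (Fin 3))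
    {φ : (Fin n → EuclideanSpace ℝ (Fin 3)) → ℝ} (hφ : ContDiff ℝ ((⊤ : ℕ∞) : WithTop ℕ∞) φ) (hφc : HasCompactSupport φ)
    (hsupp : tsupport φ ⊆ NonCoincident 3 n) :
    ∫ x, S n x * ((2 * Δ - 6) * (∑ i, inner ℝ b (x i)) * φ x +
        fderiv ℝ φ x (fun i => ‖x i‖ ^ 2 • b - (2 * inner ℝ b (x i)) • x i)) = 0 ↔
      Tendsto (fun δ => ∫ x, rescaledCorrelator (criticalCorr 3) ρ n δ x *
          ((2 * Δ - 6) * (∑ i, inner ℝ b (x i)) * φ x +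
            fderiv ℝ φ x (fun i => ‖x i‖ ^ 2 • b - (2 * inner ℝ b (x i)) • x i)))
        (𝓝[>] (0:ℝ)) (𝓝 0) := by
  have h := integral_mul_sctTestOp_eq_zero_iff_tendsto hlim (continuousOn_of_limit hlim n) Δ b hφ hφc hsupp
  simpa only [sctTestOp_three] using h

/-- **7⁗ ⟺ 7⁗_lat (registered anchor of this file)**: for every pointwise limit `S` of `criticalCorr 3` under `ρ` and every `Δ`, the
single-generator (`K_{e₀}`, `e₀ = EuclideanSpace.single 0 1`) weak Ward identities at the even levels `n ≥ 4` hold for `S` iff the rescaled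
LATTICE correlators satisfy them asymptotically in the weak sense. [cite: FrancescoMathieuSenechal1997, §4.3.1 (4.51)–(4.54)] -/
theorem k1Ward_iff_latticeK1Ward : ∀ (ρ : ℝ → ℝ) (Δ : ℝ) (S : Literature.Probability.LatticeModels.CorrFamily 3), Literature.Probability.LatticeModels.HasPointwiseScalingLimit (Literature.Probability.LatticeModels.criticalCorr 3) ρ S → ((∀ n, 4 ≤ n → Even n → ∀ (φ : (Fin n → EuclideanSpace ℝ (Fin 3)) → ℝ), ContDiff ℝ ((⊤ : ℕ∞) : WithTop ℕ∞) φ → HasCompactSupport φ → tsupport φ ⊆ Literature.Probability.LatticeModels.NonCoincident 3 n → MeasureTheory.integral MeasureTheory.volume (fun x => S n x * ((2 * Δ - 6) * (∑ i, inner ℝ (EuclideanSpace.single 0 1 : EuclideanSpace ℝ (Fin 3)) (x i)) * φ x + fderiv ℝ φ x (fun i => ‖x i‖ ^ 2 • (EuclideanSpace.single 0 1 : EuclideanSpace ℝ (Fin 3)) - (2 * inner ℝ (EuclideanSpace.single 0 1 : EuclideanSpace ℝ (Fin 3)) (x i)) • x i))) = 0) ↔ (∀ n, 4 ≤ n → Even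 n → ∀ (φ : (Fin n → EuclideanSpace ℝ (Fin 3)) → ℝ), ContDiff ℝ ((⊤ : ℕ∞) : WithTop ℕ∞) φ → HasCompactSupport φ → tsupport φ ⊆ Literature.Probability.LatticeModels.NonCoincident 3 n → Filter.Tendsto (fun δ => MeasureTheory.integral MeasureTheory.volume (fun x => Literature.Probability.LatticeModels.rescaledCorrelator (Literature.Probability.LatticeModels.criticalCorr 3) ρ n δ x * ((2 * Δ - 6) * (∑ i, inner ℝ (EuclideanSpace.single 0 1 : EuclideanSpace ℝ (Fin 3)) (x i)) * φ x + fderiv ℝ φ x (fun i => ‖x i‖ ^ 2 • (EuclideanSpace.single 0 1 : EuclideanSpace ℝ (Fin 3)) - (2 * inner ℝ (EuclideanSpace.single 0 1 : EuclideanSpace ℝ (Fin 3)) (x i)) • x i)))) (nhdsWithin (0:ℝ) (Set.Ioi 0)) (nhds 0))) :=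
  fun _ Δ _ hlim =>
    forall_congr' fun _ => forall_congr' fun _ => forall_congr' fun _ => forall_congr' fun _ =>
      forall_congr' fun hφ => forall_congr' fun hφc => forall_congr' fun hsupp =>
        integral_ward_eq_zero_iff_tendsto_lattice hlim Δ _ hφ hφc hsupp

/-- **The lattice door for 7⁗ (the direction a lattice mechanism would use)**: asymptotic single-generator even-level lattice Ward
identities give the single-generator even-level weak Ward identities of the limit. [cite: FrancescoMathieuSenechal1997, §4.3.1 (4.51)–(4.54)] -/
theorem k1Ward_of_latticeK1Ward {ρ : ℝ → ℝ} {S : CorrFamily 3}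
    (hlim : HasPointwiseScalingLimit (criticalCorr 3) ρ S) {Δ : ℝ}
    (hlat : ∀ n, 4 ≤ n → Even n → ∀ (φ : (Fin n → EuclideanSpace ℝ (Fin 3)) → ℝ),
        ContDiff ℝ ((⊤ : ℕ∞) : WithTop ℕ∞) φ → HasCompactSupport φ → tsupport φ ⊆ NonCoincident 3 n →
        Tendsto (fun δ => ∫ x, rescaledCorrelator (criticalCorr 3) ρ n δ x *
            ((2 * Δ - 6) * (∑ i, inner ℝ (EuclideanSpace.single 0 1 : EuclideanSpace ℝ (Fin 3)) (x i)) * φ x +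
              fderiv ℝ φ x (fun i => ‖x i‖ ^ 2 • (EuclideanSpace.single 0 1 : EuclideanSpace ℝ (Fin 3)) -
                (2 * inner ℝ (EuclideanSpace.single 0 1 : EuclideanSpace ℝ (Fin 3)) (x i)) • x i)))
          (𝓝[>] (0:ℝ)) (𝓝 0)) :
    ∀ n, 4 ≤ n → Even n → ∀ (φ : (Fin n → EuclideanSpace ℝ (Fin 3)) → ℝ),
        ContDiff ℝ ((⊤ : ℕ∞) : WithTop ℕ∞) φ → HasCompactSupport φ → tsupport φ ⊆ NonCoincident 3 n →
        ∫ x, S n x * ((2 * Δ - 6) * (∑ i, inner ℝ (EuclideanSpace.single 0 1 : EuclideanSpace ℝ (Fin 3)) (x i)) * φ x +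
          fderiv ℝ φ x (fun i => ‖x i‖ ^ 2 • (EuclideanSpace.single 0 1 : EuclideanSpace ℝ (Fin 3)) -
            (2 * inner ℝ (EuclideanSpace.single 0 1 : EuclideanSpace ℝ (Fin 3)) (x i)) • x i)) = 0 :=
  (k1Ward_iff_latticeK1Ward ρ Δ S hlim).2 hlat

end Summit.CriticalPhenomena.Ising3DConformalLimit.MoebiusLimitExistsLatticeWard

end
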